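import Literature.AnabelianGeometry.EtaleTheta.FreeProfinitePermBasisRetractions
import HarnessLib

/-!
# Sub-basis embeddings `F̂(T) ↪ F̂(S)` and (PBF-cyclic) ⟸ (PBF-prime) (PL3-TREEFREE §3.2 (ii))

THEOREMS ONLY (v3: no definition is declared).  For an injection `j : T → S`, `mapHat (FreeGroup.map j) : F̂(T) → F̂(S)`
is INJECTIVE (a discrete co-retraction, built inside the proof, is a left inverse after completion), has range
`clGen (range j)` («closure of a free factor = completion of the factor»), and is equivariant for compatible basis
permutations.  Background: Ribes–Zalesskii, *Profinite Groups*, §3.2 [cite: RibesZalesskii2010, §3.2]; the (PBF)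
statements are statements of the ROUTE-PBF P-chain (this packet).  THEOREM [cite: RibesZalesskii2010, §3.2]
`permBasisFixedPointsCyclic_of_prime : PermBasisFixedPointsPrime → PermBasisFixedPointsCyclic`, by strong induction on
the order `d` of `σ`: with `τ := σ^{d/q}` (`q` a prime factor), a `σ`-fixed element is `τ`-fixed, hence in
`clGen (S^τ) = embedHat (F̂(S^τ))`; pull back along the equivariant injection, apply the induction hypothesis to `σ|S^τ`
(order `< d`), push forward.

HONEST FRAMING. Classical profinite group theory (free profinite groups as completions of free groups, free profinite
products of finite groups as completions of free products); theorems only, no named-fact hypothesis; the four candidate `Prop`s of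
`FreeProfinitePermBasis.lean` are all PROVED in this packet (`_holds`); no (E)-class module and no `SettingModel*` file is
imported; nothing of [EtTh]/[IUTchII]/[IUTchIII] in print is asserted; CELL hextΔ/hΘ UNDECIDED-AT-MODEL; no side is taken on
[IUTchIII] Cor. 3.12; nothing here says abc is proved or refuted.  abc-iut cell, programme P-L2, rung (L3′), ROUTE-PBF,
P-chain (seat abc-iut-w6-d081 GEN 23; v3 GEN 24); desk: PL3-TREEFREE (abc-iut-L6-t19 g22) + PL3-PBF-READ (this seat).
-/

namespace Literature.AnabelianGeometry.EtaleTheta.SettingModel.TreeFree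

open CategoryTheory Topology
open Literature.IUT.HodgeTheaters (profiniteCompletion toCompletion)

universe u

variable {S : Type u}

/-! ### Sub-basis embeddings `F̂(T) ↪ F̂(S)` along an injection `j : T → S` -/

section Embed

variable {T : Type u} (j : T → S)

/-- `mapHat (FreeGroup.map j) : F̂(T) → F̂(S)` is continuous. [folklore] -/
private theorem continuous_embedHat : Continuous (mapHat (FreeGroup.map j : FreeGroup T →* FreeGroup S)) :=
  (ProfiniteGrp.profiniteCompletion.map
    (GrpCat.ofHom (FreeGroup.map j : FreeGroup T →* FreeGroup S))).hom.continuous_toFun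

/-- `mapHat (FreeGroup.map j) (η w) = η (FreeGroup.map j w)`. [folklore] -/
private theorem embedHat_toCompletion (w : FreeGroup T) :
    mapHat (FreeGroup.map j : FreeGroup T →* FreeGroup S) (toCompletion (FreeGroup T) w) =
      toCompletion (FreeGroup S) (FreeGroup.map j w) :=
  Literature.IUT.HodgeTheaters.ProfiniteCompletion.profiniteCompletionMap_toCompletion _ w

/-- **`mapHat (FreeGroup.map j)` is injective** for an injective `j` (the sub-basis `j(T)` generates a closed subgroup
of `F̂(S)` isomorphic to `F̂(T)`: «closure of a free factor = completion of the factor»).  Proof: the completion of the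
discrete co-retraction `FreeGroup S → FreeGroup T` (`j t ↦ t`, other letters `↦ 1`; built inside the proof) is a left
inverse, by continuity and density.  Statement of the ROUTE-PBF P-chain (this packet); cf. Ribes–Zalesskii §3.2.
[folklore] -/
private theorem embedHat_injective (hj : Function.Injective j) :
    Function.Injective (mapHat (FreeGroup.map j : FreeGroup T →* FreeGroup S)) := by
  classical
  -- the discrete co-retraction and its completion
  let c : FreeGroup S →* FreeGroup T :=
    FreeGroup.lift fun s => if h : ∃ t, j t = s then FreeGroup.of (Classical.choose h) else 1
  have c_of : ∀ t : T, c (FreeGroup.of (j t)) = FreeGroup.of t := by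
    intro t
    have h : ∃ t', j t' = j t := ⟨t, rfl⟩
    simp only [c, FreeGroup.lift_apply_of, dif_pos h]
    congr 1
    exact hj (Classical.choose_spec h)
  have c_map : ∀ w : FreeGroup T, c (FreeGroup.map j w) = w := by
    intro w
    induction w using FreeGroup.induction_on with
    | C1 => simp
    | of t => rw [FreeGroup.map.of]; exact c_of t
    | inv_of t ih => rw [map_inv, map_inv, ih]
    | mul x y hx hy => rw [map_mul, map_mul, hx, hy]
  let cHat : profiniteCompletion (FreeGroup S) →* profiniteCompletion (FreeGroup T) :=
    (ProfiniteGrp.profiniteCompletion.map (GrpCat.ofHom c)).hom.toMonoidHom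
  have cHat_cont : Continuous cHat := (ProfiniteGrp.profiniteCompletion.map (GrpCat.ofHom c)).hom.continuous_toFun
  have cHat_eta : ∀ w : FreeGroup S, cHat (toCompletion (FreeGroup S) w) = toCompletion (FreeGroup T) (c w) :=
    fun w => Literature.IUT.HodgeTheaters.ProfiniteCompletion.profiniteCompletionMap_toCompletion _ w
  -- `cHat ∘ mapHat (map j) = id`
  have hleft : ∀ w, cHat (mapHat (FreeGroup.map j : FreeGroup T →* FreeGroup S) w) = w := by
    intro w
    have h := Literature.IUT.HodgeTheaters.ProfiniteCompletion.eq_of_forall_toCompletion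
      (ψ₁ := fun v => cHat (mapHat (FreeGroup.map j : FreeGroup T →* FreeGroup S) v)) (ψ₂ := fun v => v)
      (cHat_cont.comp (continuous_embedHat j)) continuous_id
      (fun g => by simp only [embedHat_toCompletion, cHat_eta, c_map])
    exact congrFun h w
  exact Function.LeftInverse.injective hleft

/-- `FreeGroup.map j` maps `⟨Y⟩` into `⟨j '' Y⟩`. [folklore] -/
private theorem map_mem_closure_image {Y : Set T} {w : FreeGroup T} (hw : w ∈ Subgroup.closure (FreeGroup.of '' Y)) :
    FreeGroup.map j w ∈ Subgroup.closure (FreeGroup.of '' (j '' Y)) := by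
  induction hw using Subgroup.closure_induction with
  | mem x hx =>
    obtain ⟨t, ht, rfl⟩ := hx
    rw [FreeGroup.map.of]
    exact Subgroup.subset_closure ⟨j t, ⟨t, ht, rfl⟩, rfl⟩
  | one => simp
  | mul x y _ _ hx hy => rw [map_mul]; exact mul_mem hx hy
  | inv x _ hx => rw [map_inv]; exact inv_mem hx

/-- `mapHat (FreeGroup.map j)` maps `clGen Y` into `clGen (j '' Y)`. [folklore] -/
private theorem embedHat_mem_clGen_image {Y : Set T} {w : profiniteCompletion (FreeGroup T)} (hw : w ∈ clGen Y) :
    (mapHat (FreeGroup.map j : FreeGroup T →* FreeGroup S)) w ∈ clGen (j '' Y) := by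
  have hsub : (mapHat (FreeGroup.map j : FreeGroup T →* FreeGroup S)) '' clGen Y ⊆ clGen (j '' Y) := by
    refine (image_closure_subset_closure_image (continuous_embedHat j)).trans (closure_mono ?_)
    rintro _ ⟨_, ⟨x, hx, rfl⟩, rfl⟩
    exact ⟨FreeGroup.map j x, map_mem_closure_image j hx, (embedHat_toCompletion j x).symm⟩
  exact hsub ⟨w, hw, rfl⟩

/-- The range of `mapHat (FreeGroup.map j)` is `clGen (range j)`. [folklore] -/
private theorem range_embedHat : Set.range (mapHat (FreeGroup.map j : FreeGroup T →* FreeGroup S)) = clGen (Set.range j) := by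
  apply Set.Subset.antisymm
  · rintro _ ⟨w, rfl⟩
    have hw : w ∈ clGen (Set.univ : Set T) := by rw [clGen_univ]; trivial
    have := embedHat_mem_clGen_image j hw
    rwa [Set.image_univ] at this
  · have hcl : IsClosed (Set.range (mapHat (FreeGroup.map j : FreeGroup T →* FreeGroup S))) :=
      (isCompact_range (continuous_embedHat j)).isClosed
    refine hcl.closure_subset_iff.mpr ?_
    rintro _ ⟨x, hx, rfl⟩
    -- x ∈ ⟨range j⟩ ⊆ range (FreeGroup.map j)
    have hx' : x ∈ (FreeGroup.map j : FreeGroup T →* FreeGroup S).range := by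
      refine (Subgroup.closure_le _).mpr ?_ hx
      rintro _ ⟨_, ⟨t, rfl⟩, rfl⟩
      exact ⟨FreeGroup.of t, FreeGroup.map.of⟩
    obtain ⟨w, rfl⟩ := hx'
    exact ⟨toCompletion (FreeGroup T) w, embedHat_toCompletion j w⟩

/-- An element of `clGen (range j)` is in the image of `mapHat (FreeGroup.map j)`. [folklore] -/
private theorem exists_embedHat_eq_of_mem_clGen {w : profiniteCompletion (FreeGroup S)} (hw : w ∈ clGen (Set.range j)) :
    ∃ v, (mapHat (FreeGroup.map j : FreeGroup T →* FreeGroup S)) v = w := by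
  rw [← range_embedHat] at hw
  exact hw

/-- **Equivariance**: if `σ ∘ j = j ∘ τ` then `mapHat (FreeGroup.map j) ∘ permHat τ = permHat σ ∘ mapHat (FreeGroup.map j)`. [folklore] -/
private theorem embedHat_permHat (σ : Equiv.Perm S) (τ : Equiv.Perm T) (hστ : ∀ t, σ (j t) = j (τ t))
    (w : profiniteCompletion (FreeGroup T)) : (mapHat (FreeGroup.map j : FreeGroup T →* FreeGroup S)) (permHat τ w) = permHat σ ((mapHat (FreeGroup.map j : FreeGroup T →* FreeGroup S)) w) := by
  have h := Literature.IUT.HodgeTheaters.ProfiniteCompletion.eq_of_forall_toCompletion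
    (ψ₁ := fun v => (mapHat (FreeGroup.map j : FreeGroup T →* FreeGroup S)) (permHat τ v)) (ψ₂ := fun v => permHat σ ((mapHat (FreeGroup.map j : FreeGroup T →* FreeGroup S)) v))
    ((continuous_embedHat j).comp (continuous_permHat τ)) ((continuous_permHat σ).comp (continuous_embedHat j))
    (fun g => by
      have hc : (j ∘ (τ : T → T)) = ((σ : S → S) ∘ j) := funext fun t => (hστ t).symm
      simp only [embedHat_toCompletion, permHat_toCompletion, FreeGroup.map.comp, hc])
  exact congrFun h w

end Embed

/-! ### (PBF) for cyclic groups ⟸ (PBF) for permutations of prime exponent (PL3-TREEFREE §3.2 (ii)) -/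


/-- **Reduction (ii) of PL3-TREEFREE §3.2**: (PBF) for ONE permutation of arbitrary (finite) order follows from the
prime-exponent case, by induction on the order `d`: for `d = q·d′` put `τ := σ^{d′}` (`τ^q = 1`); a `σ`-fixed `w`
is `τ`-fixed, so `w ∈ clGen (S^τ) = embedHat(F̂(S^τ))`; `σ` restricts to `S^τ` with `(σ|)^{d′} = 1`, order `< d`;
pull back along the injective equivariant `mapHat (FreeGroup.map Subtype.val)`, apply the induction hypothesis on
`F̂(S^τ)`, push forward.  Statement of the ROUTE-PBF P-chain (this packet); cf. Ribes–Zalesskii §3.2 for the completion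
functor. [cite: RibesZalesskii2010, §3.2] -/
theorem permBasisFixedPointsCyclic_of_prime (h : PermBasisFixedPointsPrime.{u}) : PermBasisFixedPointsCyclic.{u} := by
  -- strong induction on the order of σ, uniformly in the (finite) basis
  suffices H : ∀ (d : ℕ) (S : Type u) [Fintype S] (σ : Equiv.Perm S), orderOf σ = d →
      ∀ w : profiniteCompletion (FreeGroup S), permHat σ w = w → w ∈ clGen {s : S | σ s = s} from
    fun S _ σ w hw => H (orderOf σ) S σ rfl w hw
  intro d
  induction d using Nat.strong_induction_on with
  | _ d ih =>
  intro S _ σ hd w hw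
  by_cases hd1 : d = 1
  · -- σ = 1: every letter is fixed
    subst hd1
    have hσ : σ = 1 := orderOf_eq_one_iff.mp hd
    subst hσ
    have : {s : S | (1 : Equiv.Perm S) s = s} = Set.univ := by ext s; simp
    rw [this, clGen_univ]; trivial
  · -- d ≠ 1: pick a prime q ∣ d, d = q * d'
    have hdpos : 0 < d := by rw [← hd]; exact orderOf_pos σ
    obtain ⟨q, hq, hqd⟩ := Nat.exists_prime_and_dvd hd1
    obtain ⟨d', hdd'⟩ := hqd
    set τ : Equiv.Perm S := σ ^ d' with hτ
    have hτq : τ ^ q = 1 := by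
      rw [hτ, ← pow_mul, mul_comm, ← hdd', ← hd]; exact pow_orderOf_eq_one σ
    -- w is τ-fixed, hence in clGen (S^τ)
    have hwτ : permHat τ w = w := permHat_pow_apply_of_fixed σ hw d'
    have hw1 : w ∈ clGen {s : S | τ s = s} := h S τ q hq hτq w hwτ
    -- the sub-basis T = S^τ and the restriction σ₁ of σ to it
    let P : S → Prop := fun s => τ s = s
    have hP : ∀ s, P (σ s) ↔ P s := by
      intro s
      have hcomm : τ (σ s) = σ (τ s) := by
        rw [hτ, ← Equiv.Perm.mul_apply, ← Equiv.Perm.mul_apply, ← pow_succ, ← pow_succ']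
      simp only [P, hcomm]
      exact σ.injective.eq_iff
    let σ₁ : Equiv.Perm {s // P s} := σ.subtypePerm hP
    have hj : Function.Injective (Subtype.val : {s // P s} → S) := Subtype.val_injective
    have hrange : Set.range (Subtype.val : {s // P s} → S) = {s : S | τ s = s} := by
      ext s; simp [P]
    -- pull w back to F̂(T)
    rw [← hrange] at hw1
    obtain ⟨v, rfl⟩ := exists_embedHat_eq_of_mem_clGen Subtype.val hw1
    have hστ : ∀ t : {s // P s}, σ (Subtype.val t) = Subtype.val (σ₁ t) := fun t => rfl
    have hv : permHat σ₁ v = v := by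
      apply embedHat_injective Subtype.val hj
      rw [embedHat_permHat Subtype.val σ σ₁ hστ, hw]
    -- the order of σ₁ divides d' < d
    have hσ₁pow : σ₁ ^ d' = 1 := by
      rw [Equiv.Perm.subtypePerm_pow]
      ext t
      rw [Equiv.Perm.subtypePerm_apply]
      exact t.2
    have hd'pos : 0 < d' := by
      rcases Nat.eq_zero_or_pos d' with h0 | h0
      · rw [h0, mul_zero] at hdd'; omega
      · exact h0
    have hlt : orderOf σ₁ < d := by
      have h1 : orderOf σ₁ ≤ d' := orderOf_le_of_pow_eq_one hd'pos hσ₁pow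
      have h2 : d' < d := by
        rw [hdd']
        have := hq.two_le
        nlinarith
      omega
    haveI : Fintype {s // P s} := Fintype.ofFinite _
    have hv1 : v ∈ clGen {t : {s // P s} | σ₁ t = t} := ih (orderOf σ₁) hlt {s // P s} σ₁ rfl v hv
    -- push forward
    have hv2 := embedHat_mem_clGen_image Subtype.val hv1
    refine clGen_mono ?_ hv2
    rintro _ ⟨t, ht, rfl⟩
    have : (σ₁ t : S) = (t : S) := by rw [ht]
    simpa [σ₁, Equiv.Perm.subtypePerm_apply] using this



end Literature.AnabelianGeometry.EtaleTheta.SettingModel.TreeFree
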